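import Summits.ResolutionOfSingularities.ResolutionOfSingularities.Theorems.EquisingularLiftEquisingularLiftNatSpecimenFermatConeAlgebra
import Summits.ResolutionOfSingularities.ResolutionOfSingularities.Theorems.EquisingularLiftEquisingularLiftNatSpecimenFermatConeForms
import Literature.AlgebraicGeometry.Motives.HypersurfaceCharts
import Literature.AlgebraicGeometry.Motives.HypersurfaceChartAlgebra
import Literature.AlgebraicGeometry.Motives.ProjectiveSpaceFieldPointsBijective
import Literature.AlgebraicGeometry.Resolution.PointBlowupAlgebraCharts
import HarnessLib

/-!
# [OURS · L1 W4.5(b)] EL♮ specimen family T-ISO-CONE — the FERMAT CONES: the chart rings `ChartRing F_d c` and the blow-up chart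
# rings over the vertex chart are regular (crux `Theses.EquisingularLift.EquisingularLiftNat`, stmt-ResolutionOfSingularities-20038)

NOT a statement of any manuscript; OURS kernel specimen (cell `res-hironaka`, chain w45b, CHAIN v7.4 §3 row T-ISO-1, step 0;
seat res-D-pv-013, own initiative, counted 0). AI-written, weaker than expert review.

* `exists_chartQuotEquiv` — GENERIC, for any homogeneous `F ∈ k[x₀,…,x₃]`: `ChartRing F c ≃+* k[y₀,y₁,y₂]/(f)` for `f = F(x_c := 1)` with
  `(f)` radical, taking `x_{c.succAbove j}/x_c ↦ ȳ_j` (dehomogenization, Hartshorne I Thm 3.4 on the reduced induced structure II Example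
  3.2.6; res-D-pv-022's `WhitneyCubic.chartQuotEquiv`, p508519, is the same construction for its cubic);
* `isRegularRing_chartRing_of_ne_zero` — for `c ≠ 0`, `ChartRing F_d c ≅ k[y]/(1 + y₁ᵈ + y₂ᵈ)` is regular (`d ≠ 0` in `k`);
* `isRegularRing_blowupAlgebra_tautVec` — on the vertex chart `D₊(x₀)` the affine blowup algebras `(ChartRing F_d 0)[I/(x_a/x₀)]`,
  `I = (x₁/x₀, x₂/x₀, x₃/x₀)`, `a = 1, 2, 3`, are regular — transported from `FermatCone.isRegularRing_vertexChart` (…FermatConeAlgebra)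
  along `ChartRing F_d 0 ≅ k[y]/(y₀ᵈ + y₁ᵈ + y₂ᵈ)`.

References: Hartshorne 1977 I Thm 3.4, II Example 3.2.6; the cited tree files.
-/

set_option linter.dupNamespace false -- mandated namespace `Summit.<Summit>.<Problem>` of this single-conjunct summit

noncomputable section

open MvPolynomial HomogeneousLocalization
open Literature.AlgebraicGeometry.Resolution
open Literature.AlgebraicGeometry.Motives Literature.AlgebraicGeometry.Motives.SmoothHypersurface
open Literature.AlgebraicGeometry.Motives.ProjectiveSpace

namespace Summit.ResolutionOfSingularities.ResolutionOfSingularities.Cruxes.EquisingularLiftNat.Sections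

namespace FermatCone

variable (k : Type) [Field k] (d : ℕ)

attribute [local instance] MvPolynomial.gradedAlgebra ProjBaseChange.algebraBase

/-! ## The chart rings `ChartRing F c ≅ k[y]/(F(x_c := 1))` — any homogeneous `F ∈ k[x₀, …, x₃]` -/

section ChartRings

variable {k}

/-- **`ChartRing F c ≃+* k[y₀, y₁, y₂]/(f)`** for a homogeneous `F ∈ k[x₀,…,x₃]`, `f = F(x_c := 1)` with `(f)` radical, taking the
tautological coordinate `x_{c.succAbove j}/x_c` to `ȳ_j` (dehomogenization, Hartshorne I Thm 3.4, on the reduced induced structure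
II Example 3.2.6). [folklore] -/
theorem exists_chartQuotEquiv (F : MvPolynomial (Fin 4) k) {e : ℕ} (hF : F.IsHomogeneous e) (c : Fin 4) (f : MvPolynomial (Fin 3) k)
    (hf : dehomogenize k c F = f) (hrad : (Ideal.span {f}).radical = Ideal.span {f}) :
    ∃ θ : ChartRing F c hF ≃+* (MvPolynomial (Fin 3) k ⧸ Ideal.span {f}),
      ∀ j : Fin 3, θ (tautVec F c hF (c.succAbove j)) = Ideal.Quotient.mk _ (X j) := by
  have h1 : chartAlgEquiv k c (chartEqn F c hF) = dehomogenize k c F := by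
    rw [chartEqn, isLocalizationElem_X]
    exact (chartAlgEquiv k c).apply_symm_apply _
  have hmapspan : (Ideal.span {chartEqn F c hF}).map (chartAlgEquiv k c).toRingEquiv.toRingHom = Ideal.span {f} := by
    rw [Ideal.map_span, Set.image_singleton]
    exact congrArg (fun q => Ideal.span {q}) (h1.trans hf)
  have hideal : chartIdeal F c hF = Ideal.span {chartEqn F c hF} := by
    have hspan : Ideal.span {chartEqn F c hF} = (Ideal.span {f}).comap (chartAlgEquiv k c).toRingEquiv.toRingHom := by
      rw [← hmapspan]
      exact (Ideal.comap_map_of_bijective (chartAlgEquiv k c).toRingEquiv.toRingHom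
        (chartAlgEquiv k c).toRingEquiv.bijective).symm
    rw [chartIdeal, hspan, ← Ideal.comap_radical, hrad]
  have hmap : Ideal.span {f} = (chartIdeal F c hF).map (chartAlgEquiv k c).toRingEquiv.toRingHom := by
    rw [hideal, hmapspan]
  refine ⟨Ideal.quotientEquiv _ _ (chartAlgEquiv k c).toRingEquiv hmap, fun j => ?_⟩
  have hq : Ideal.quotientEquiv _ _ (chartAlgEquiv k c).toRingEquiv hmap (toChartRing F c hF (coord c (c.succAbove j))) =
      Ideal.Quotient.mk _ (chartAlgEquiv k c (coord c (c.succAbove j))) :=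
    Ideal.quotientEquiv_mk _ _ _ _ _
  rw [tautVec_apply]
  refine hq.trans ?_
  rw [coord_succAbove, ← chartAlgEquiv_symm_X k c j, AlgEquiv.apply_symm_apply]

end ChartRings

/-- **The chart rings off the vertex are regular**: for `c ≠ 0`, `ChartRing F_d c ≅ k[y]/(1 + y₁ᵈ + y₂ᵈ)` is a regular ring
(`d ≠ 0` in `k`). [folklore] -/
theorem isRegularRing_chartRing_of_ne_zero (hdk : (d : k) ≠ 0) (c : Fin 4) (hc : c ≠ 0) :
    IsRegularRing (ChartRing (form k d) c (isHomogeneous_form k d)) := by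
  obtain ⟨θ, -⟩ := exists_chartQuotEquiv (form k d) (isHomogeneous_form k d) c _ (dehomogenize_form_of_ne_zero k d c hc)
    (radical_span_f₁ k d hdk)
  haveI := isRegularRing_quotient_f₁ k d hdk
  exact IsRegularRing.of_ringEquiv θ.symm

/-- **The blow-up chart rings over the vertex chart are regular**: for the centre `I = (x₁/x₀, x₂/x₀, x₃/x₀)` of `ChartRing F_d 0` and
`b = x_a/x₀` (`a = 1, 2, 3`), the affine blowup algebra `(ChartRing F_d 0)[I/b]` is a regular ring — transported along
`ChartRing F_d 0 ≅ k[y]/(y₀ᵈ + y₁ᵈ + y₂ᵈ)` (`x_{j+1}/x₀ ↦ ȳ_j`) from `FermatCone.isRegularRing_vertexChart`. [folklore] -/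
theorem isRegularRing_blowupAlgebra_tautVec [IsAlgClosed k] (hdk : (d : k) ≠ 0) (a : Fin (0 + 3 + 1)) (ha : 0 + 1 ≤ (a : ℕ)) :
    IsRegularRing (blowupAlgebra
      (Ideal.span (Set.range fun c' : {c' : Fin (0 + 3 + 1) // 0 + 1 ≤ (c' : ℕ)} =>
        tautVec (form k d) 0 (isHomogeneous_form k d) c'.1))
      (tautVec (form k d) 0 (isHomogeneous_form k d) a)) := by
  obtain ⟨θ, hθ⟩ := exists_chartQuotEquiv (form k d) (isHomogeneous_form k d) 0 _ (dehomogenize_form_zero k d)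
    (radical_span_f₀ k d hdk)
  simp only [Fin.succAbove_zero] at hθ
  obtain ⟨j, rfl⟩ : ∃ j : Fin 3, Fin.succ j = a := Fin.exists_succ_eq.mpr (by rintro rfl; simp at ha)
  refine WhitneyCubic.isRegularRing_blowupAlgebra_of_ringEquiv θ _ _ ?_
  have hrange : (⇑θ.toRingHom ∘ fun c' : {c' : Fin (0 + 3 + 1) // 0 + 1 ≤ (c' : ℕ)} =>
      tautVec (form k d) 0 (isHomogeneous_form k d) c'.1) '' Set.univ =
      (⇑(Ideal.Quotient.mk (Ideal.span {(X 0 ^ d + X 1 ^ d + X 2 ^ d : MvPolynomial (Fin 3) k)})) ∘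
        (MvPolynomial.X : Fin 3 → MvPolynomial (Fin 3) k)) '' Set.univ := by
    rw [Set.image_univ, Set.image_univ]
    ext q
    constructor
    · rintro ⟨⟨c', hc'⟩, rfl⟩
      obtain ⟨i, rfl⟩ : ∃ i : Fin 3, Fin.succ i = c' := Fin.exists_succ_eq.mpr (by rintro rfl; simp at hc')
      exact ⟨i, (hθ i).symm⟩
    · rintro ⟨i, rfl⟩
      exact ⟨⟨i.succ, by simp [Fin.val_succ]⟩, hθ i⟩
  have hI : (Ideal.span (Set.range fun c' : {c' : Fin (0 + 3 + 1) // 0 + 1 ≤ (c' : ℕ)} =>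
      tautVec (form k d) 0 (isHomogeneous_form k d) c'.1)).map θ.toRingHom =
      (PointBlowup.originIdeal 2 k).map (Ideal.Quotient.mk (Ideal.span {(X 0 ^ d + X 1 ^ d + X 2 ^ d : MvPolynomial (Fin 3) k)})) := by
    change _ = Ideal.map _ (Ideal.span (Set.range MvPolynomial.X))
    rw [Ideal.map_span, Ideal.map_span, ← Set.image_univ, ← Set.image_comp, hrange, Set.image_comp, Set.image_univ]
  rw [hI]
  erw [hθ j]
  exact isRegularRing_vertexChart k d hdk j

end FermatCone

end Summit.ResolutionOfSingularities.ResolutionOfSingularities.Cruxes.EquisingularLiftNat.Sections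

end
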